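import Literature.AlgebraicGeometry.Motives.QuadraticFormSingularRadical
import Literature.AlgebraicGeometry.Motives.QuadraticFormsSmallRank
import Literature.AlgebraicGeometry.Motives.GeneralNonsingularForms
import HarnessLib

/-!
# Normal form of a PRIME quadratic form over an algebraically closed field of any characteristic:
# a cone over a nonsingular quadric in at least three variables

Topic `Literature/AlgebraicGeometry/Motives`; THEOREMS ONLY (no definition, no instance, no named fact).  Assembles
`Motives/QuadraticFormSingularRadical` (splitting off the singular radical, every characteristic), `Motives/QuadraticFormsSmallRank`
(quadratic forms in `≤ 2` variables are reducible) and `Motives/GeneralNonsingularForms` (Nullstellensatz form of `IsNonsingularForm`):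

* `isNonsingularForm_rename_of_forall_eval` — if the affine cone of a form `G` in `a` variables has no singular point `≠ 0` and
  `ι : Fin a → Fin (m + 2)` is injective, then `rename ι G` is a nonsingular form as soon as «`z ∘ ι = 0` forces `z = 0`» on common zeros
  (used with `ι` a bijection);
* ★ `exists_linearSubst_eq_rename_nonsingular_of_prime` — **Hartshorne I Ex. 5.12 (d) in every characteristic**: a PRIME quadratic form
  `F(x₀, …, x_{n+1})` over an algebraically closed field becomes, under an invertible linear substitution, `G(x₀, …, x_{m+1})` for a
  NONSINGULAR quadratic form `G` in `m + 2 ≥ 3` variables (`n + 2 = (m + 2) + c`, the last `c ≥ 0` variables idle): the quadric `V₊(F)` is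
  the cone with vertex `ℙ^{c-1}` over the smooth quadric `V₊(G) ⊆ ℙ^{m+1}` (`c = 0`: `V₊(F)` itself is smooth).  In characteristic `≠ 2` this is
  Hartshorne's exercise (rank of the symmetric matrix); in characteristic `2` the vertex is the quadratic radical `rad F ⊊ rad b_F`
  (Elman–Karpenko–Merkurjev §7) and `G` is the regular part, smooth as a projective quadric although `b_G` may be degenerate.

## References

* R. Hartshorne, *Algebraic Geometry*, GTM 52 (1977), I Ex. 5.12 (c),(d). [Hartshorne1977]
* R. Elman, N. Karpenko, A. Merkurjev, *The Algebraic and Geometric Theory of Quadratic Forms* (2008), §7. [ElmanKarpenkoMerkurjev2008]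

## Provenance

Cell `pub/decomp-res` (summit `ResolutionOfSingularities`, route `EquisingularLift`), seat `leafhand-res-equisingularlift-6` g3 (prover),
2026-08-31.  AI-produced, weaker than expert review.
-/

noncomputable section

universe u

namespace Literature.AlgebraicGeometry.Motives

namespace ProjectiveSpaceCells

open _root_.MvPolynomial SmoothHypersurface

variable {k : Type u} [Field k] [IsAlgClosed k]

/-- **Nonsingularity of a renamed form from the affine cone.**  If every common zero `u` of `G` and all `∂ⱼG` is `0`, `ι` is injective, and
common zeros `z` of `rename ι G` and its partials with `z ∘ ι = 0` vanish, then `rename ι G` is a nonsingular form (Hilbert's Nullstellensatz,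
`isNonsingularForm_of_forall_exists_eval_pderiv_ne_zero`, with `pderiv_rename` / `eval_rename`). [cite: Hartshorne1977, I Ex. 5.8] -/
theorem isNonsingularForm_rename_of_forall_eval {a m : ℕ} {G : MvPolynomial (Fin a) k}
    (hns : ∀ u : Fin a → k, eval u G = 0 → (∀ j, eval u (pderiv j G) = 0) → u = 0)
    (ι : Fin a → Fin (m + 2)) (hι : Function.Injective ι)
    (hz : ∀ z : Fin (m + 2) → k, z ∘ ι = 0 → eval z (rename ι G) = 0 → (∀ j, eval z (pderiv j (rename ι G)) = 0) → z = 0) :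
    IsNonsingularForm k (rename ι G) := by
  refine isNonsingularForm_of_forall_exists_eval_pderiv_ne_zero fun z hz0 hGz => ?_
  by_contra hall
  push Not at hall
  have hzι : z ∘ ι = 0 := hns (z ∘ ι) (by rwa [← eval_rename]) fun j => by
    rw [← eval_rename, ← pderiv_rename hι]; exact hall (ι j)
  exact hz0 (hz z hzι hGz hall)

/-- ★ **Normal form of a prime quadratic form over an algebraically closed field, every characteristic** (Hartshorne I Ex. 5.12 (d)
without `char k ≠ 2`): for a prime quadratic form `F(x₀, …, x_{n+1})` there are mutually inverse invertible linear substitutions `τ, τ'`,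
a splitting `(m + 2) + c = n + 2` and a NONSINGULAR quadratic form `G` in `m + 2 ≥ 3` variables with `σ_τ F = G(x₀, …, x_{m+1})`
(`rename` along `Fin.castAdd c`; the last `c` variables are idle).  Proof: split off the singular radical
(`exists_linearSubst_eq_rename_of_isHomogeneous_two`); the regular part `G` is irreducible like `F` (`irreducible_of_irreducible_rename`), hence
has `≥ 3` variables (`not_irreducible_of_isHomogeneous_two_fin_one/_two`); its cone has no singular point `≠ 0`, i.e. `G` is a nonsingular
form by the Nullstellensatz. [cite: Hartshorne1977, I Ex. 5.12 (d); ElmanKarpenkoMerkurjev2008, §7] -/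
theorem exists_linearSubst_eq_rename_nonsingular_of_prime {n : ℕ} (F : MvPolynomial (Fin (n + 2)) k)
    (hF : F.IsHomogeneous 2) (hprime : Prime F) :
    ∃ (τ τ' : Fin (n + 2) → MvPolynomial (Fin (n + 2)) k) (m c : ℕ) (hmc : m + 2 + c = n + 2)
      (G : MvPolynomial (Fin (m + 2)) k),
      (∀ j, (τ j).IsHomogeneous 1) ∧ (∀ j, (τ' j).IsHomogeneous 1) ∧
        (∀ p, aeval τ (aeval τ' p) = p) ∧ (∀ p, aeval τ' (aeval τ p) = p) ∧ 1 ≤ m ∧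
          G.IsHomogeneous 2 ∧ IsNonsingularForm k G ∧
            aeval τ F = rename (fun l : Fin (m + 2) => Fin.cast hmc (Fin.castAdd c l)) G := by
  classical
  obtain ⟨a, c, hac, τ, τ', G, hτ, hτ', hinv, hinv', hG, hkey, hns⟩ :=
    exists_linearSubst_eq_rename_of_isHomogeneous_two (N := n + 1) hF
  have hιinj : Function.Injective (fun l : Fin a => Fin.cast hac (Fin.castAdd c l)) :=
    (Fin.cast_injective hac).comp (Fin.castAdd_injective _ _)
  -- `σ_τ F` is prime, hence `G` is irreducible, hence `a ≥ 3`
  have hprime' : Prime (aeval τ F) := by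
    have h1 : (aeval τ').comp (aeval τ) = AlgHom.id k _ := MvPolynomial.algHom_ext fun i => by
      simpa using hinv' (X i)
    have h2 : (aeval τ).comp (aeval τ') = AlgHom.id k _ := MvPolynomial.algHom_ext fun i => by
      simpa using hinv (X i)
    exact (MulEquiv.prime_iff (AlgEquiv.ofAlgHom (aeval τ) (aeval τ') h2 h1)).mpr hprime
  have hirrG : Irreducible G := by
    refine irreducible_of_irreducible_rename hιinj ?_
    rw [← hkey]
    exact hprime'.irreducible
  have ha3 : 3 ≤ a := by
    by_contra hlt
    interval_cases a
    · exact hirrG.ne_zero (eq_zero_of_isHomogeneous_two_fin_zero hG)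
    · exact not_irreducible_of_isHomogeneous_two_fin_one hG hirrG
    · exact not_irreducible_of_isHomogeneous_two_fin_two hG hirrG
  obtain ⟨m, rfl⟩ : ∃ m, a = m + 2 := ⟨a - 2, by omega⟩
  refine ⟨τ, τ', m, c, hac, G, hτ, hτ', hinv, hinv', by omega, hG, ?_, hkey⟩
  have h := isNonsingularForm_rename_of_forall_eval hns id Function.injective_id fun z hz _ _ => hz
  simpa using h

end ProjectiveSpaceCells

end Literature.AlgebraicGeometry.Motives

end
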